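import Summits.FinalStateConjecture.FinalStateConjecture.Cruxes.KillingSpinorEndgame.Lines.birth
import Summits.FinalStateConjecture.FinalStateConjecture.Theorems.KerrnessPropagatesKillingSpinorEndgameInteriorIdle
import Summits.FinalStateConjecture.FinalStateConjecture.Theorems.ClusterCompletenessRecurrentlyFlatDispersesRestart

/-!
# Line `registered`, RESHAPED by the orthochronous sector split (c5) AND the dispersal split (c6)
# — crux `KillingSpinorEndgame` (stmt-FinalStateConjecture-17645), route `KerrnessPropagates`

Target workfile: `Cruxes/KillingSpinorEndgame/Lines/registered.lean`. Continuation lead c6 (seventh lead),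
2026-08-17. Previous text: c5's reshape (skeleton sha 06efb835…; stubs `stub_dynamicsOrtho` /
`stub_packagingOrtho` / `stub_whiteHoleSector`), itself the reshape of `Lines/birth.lean` whose stubs are answered
on the tree (`stub_eventualCapture` FALSE on paper, `Lines/registered_dead.md` §2; stubs 2–3 misstated, w1/w2).

THE c6 RESHAPE. c5's composition — case split on `∀ i, IsOrthochronous (mo i).1`; orthochronous ⇒ DYNAMICS
(`stub_dynamicsOrtho`: recurrence ⇒ one convergent global gauge to an orthochronous `p′ = (N′; …)`) then PACKAGING
(global gauge ⇒ honest exterior); otherwise the white-hole sector stub — is kept, and the packaging step is split by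
the one further case distinction every packaging proof must make on the configuration the dynamics stub hands it:
`N′ = 0` (DISPERSAL: the convergent gauge is ONE flat chart on the whole late half-space) or `0 < N′`.

* `stub_packagingOrthoPos` — c5's `stub_packagingOrtho` restricted to `0 < N` (content unchanged: w2's XL causal
  bookkeeping, `Lines/birth_w2_StubExteriorPackaging.md` §5).
* The `N = 0` packaging `GlobalGauge 𝒟 3 0 → HonestExterior 𝒟` is PROVED here (`packagingFlat_of`) modulo two
  worker-sized stubs stated in Theorems-importable vocabulary (no waypoint names), because a convergent `N = 0`
  global gauge IS an ANCHORED FLAT LATE CHART from some base time `τb` on (its far zone is the whole leaf, so the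
  `C³` sup bound `≤ δ(τ) → 0` gives the pointwise `C⁰` anchor `‖Φ^*g − η‖ ≤ 1/4` and `Φ_*∂₀` future-directed on
  `{x⁰ > τb}` — `anchor_of_gaugeAlong` below), and for anchored flat charts the kernel-checked bricks of crux
  stmt-14665 `RecurrentlyFlatDisperses` (route ClusterCompleteness) apply: the late image `Φ{x⁰ > τ}` is a FUTURE
  SET and timelike curves inside it lift with increasing chart time and displacement `≤ 2 Δx⁰`
  (`FutureSet.forall_mem_range`, `lift_cone`, `cone_of_deviation`, `norm_sub_le_of_hasDerivAt`), the late image is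
  past-full along chart verticals (`Restart.image_lateRegion_subset_chronologicalPast`), and a convergent exhausting
  flat chart packages into the `N = 0` decomposition (`decomp_of_convergentChart`).
  - `stub_flatExhaustion` (the ONE new theorem): for an anchored flat chart of a vacuum Cauchy development and
    `τb < τ₁ ≤ τ`, the part of the self-determined exterior `J⁺(ιX) ∩ I⁻(Φ{x⁰ > τ₁})` not in `Φ{x⁰ > τ}` lies in
    `J⁻(Φ{x⁰ = τ})` — FIRST ENTRY of a timelike curve `p ≪ c ∈ Φ{x⁰ > τ}` into the (open, future) set `Φ{x⁰ > τ}`;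
    the coordinate lift on `(s₀, b]` has chart time DEcreasing towards the entry parameter and bounded below by `τ`,
    so it is Cauchy (displacement bound) and converges in `U ⊇ {x⁰ > τb}`; its limit is charted, not in the open late
    image, hence ON the slab; no frontier-at-infinity analysis is needed (that is the first-EXIT problem, already
    solved by the bricks).
  - `stub_flatDecomp`: `decomp_of_convergentChart` plus `IsFutureOriented` (clauses (i)–(ii) vacuous for `N = 0`,
    (iii) = the orientation hypothesis).

`KillingSpinorEndgame_of` composes BY NAME over the five stubs: `k := max k₁ k₂`; sector split; on the orthochronous
sector dynamics gives `(N′, p′, GlobalGauge 𝒟 3 N′ p′)`; `N′ = 0` ⇒ `packagingFlat_of`; `0 < N′` ⇒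
`stub_packagingOrthoPos`; white-hole sector ⇒ `stub_whiteHoleSector`; hypothesis (ii) decorates `(O, d)` with
`RaysStayInClosure O` (F6, p158979). Sorries: exactly the five `stub_*`. Disproof.lean for this crux: none exists
(2026-08-17T18:30Z).
-/

open Literature.Geometry.Lorentzian
open scoped Manifold ContDiff Topology ENNReal
open Filter Set TopologicalSpace

-- every `Summit.FinalStateConjecture.FinalStateConjecture.…` name repeats the summit = sub-problem
-- segment (D-0017 layout, CONVENTIONS §2); the duplicate is deliberate.
set_option linter.dupNamespace false

namespace Summit.FinalStateConjecture.FinalStateConjecture.Cruxes.KillingSpinorEndgame.Registered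

open Summit.FinalStateConjecture.FinalStateConjecture.Theses.KerrnessPropagates
open Summit.FinalStateConjecture.FinalStateConjecture.Cruxes.KillingSpinorEndgame.Birth
  (Recurs GaugeAlong GlobalGauge HonestExterior)
open Summit.FinalStateConjecture.FinalStateConjecture.Theorems.KerrnessPropagates (SlabClauses)
open Summit.FinalStateConjecture.FinalStateConjecture.Theorems.RecurrentlyFlatDisperses

noncomputable section

/-! ### §0 Waypoints -/

section Waypoints

variable {X : Type} [TopologicalSpace X] [ChartedSpace E3 X] [IsManifold (𝓡 3) ∞ X]
  [ConnectedSpace X] {D : InitialDataSet (𝓡 3) X}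

/-- **Orthochronous sub-extremal horizon-penetrating configuration** (the repaired side conditions of a
recurrence configuration `p = (N; Mᵢ, aᵢ, r₀ᵢ; Λᵢ, cᵢ)`, finding F2): `|aᵢ| < Mᵢ`, `r₀ᵢ ∈ (r₋, r₊)`, and every
motion `Λᵢ` orthochronous (`Summit.FinalStateConjecture.IsOrthochronous`, the Statement's own predicate), so that
`boostedKerrBilin Λᵢ cᵢ Mᵢ aᵢ` is an INGOING (black-hole) Kerr–Schild reference. [cite: ONeill1983, Ch. 9 pp. 233–236] -/
def OrthoConfig {N : ℕ} (M a r₀ : Fin N → ℝ) (mo : Fin N → ↥lorentzGroup × E4) : Prop :=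
  ∀ i, Kerr.IsSubextremal (M i) (a i) ∧
    r₀ i ∈ Ioo (Kerr.rMinus (M i) (a i)) (Kerr.rPlus (M i) (a i)) ∧
    Summit.FinalStateConjecture.IsOrthochronous (mo i).1

/-- `Birth.Recurs` is the crux's clause (i) verbatim: it unfolds, by `Iff.rfl`, to
`∀ ε > 0, ∀ τ₁, ∃ τ ≥ τ₁, ∃ R U Φ, SlabClauses 𝒟 k …` (p152635's `SlabClauses`). [folklore] -/
theorem recurs_iff_slabClauses (𝒟 : VacuumCauchyDevelopment D) (k N : ℕ) (M a r₀ : Fin N → ℝ)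
    (mo : Fin N → ↥lorentzGroup × E4) :
    Recurs 𝒟 k N M a r₀ mo ↔
      ∀ ε : ℝ, 0 < ε → ∀ τ₁ : ℝ, ∃ τ : ℝ, τ₁ ≤ τ ∧
        ∃ (R : Fin N → ℝ) (U : Opens E4) (Φ : U → 𝒟.carrier), SlabClauses 𝒟 k N M a r₀ mo ε τ R U Φ :=
  Iff.rfl

/-- **Recurrence is antitone in the regularity** (the two `Cᵏ` sup norms are monotone in `k`,
`SlabClauses.anti`, p158979): recurrence at `k'` to a configuration implies recurrence at every `k ≤ k'` to
the SAME configuration. [cite: arXiv210408222, §1] -/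
theorem recurs_anti (𝒟 : VacuumCauchyDevelopment D) {k k' N : ℕ} (hk : k ≤ k') {M a r₀ : Fin N → ℝ}
    {mo : Fin N → ↥lorentzGroup × E4} (h : Recurs 𝒟 k' N M a r₀ mo) : Recurs 𝒟 k N M a r₀ mo := by
  rw [recurs_iff_slabClauses] at h ⊢
  intro ε hε τ₁
  obtain ⟨τ, hτ, R, U, Φ, hs⟩ := h ε hε τ₁
  exact ⟨τ, hτ, R, U, Φ, hs.anti hk⟩

end Waypoints

/-! ### §1 The stub SIGNATURES (`Sig.stub_<name> : Prop`; heads = stub names) -/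

/-- **Signature of stub 1 — DYNAMICS on the orthochronous sector** (carries the whole open-problem
difficulty; unchanged from c5): there is a regularity `k` such that for every admissible datum, every MGHD with
complete `𝓘⁺` and every ORTHOCHRONOUS sub-extremal horizon-penetrating configuration `p`: if the development
recurs to `p` at regularity `k` (`Birth.Recurs`, the crux's clause (i) verbatim), then it carries ONE convergent
global gauge of regularity `3` (`Birth.GlobalGauge 𝒟 3`) to SOME orthochronous sub-extremal horizon-penetrating
configuration `p′` (re-description allowed: charges, motions, depths and even `N` may be re-fitted). Content:
sub-extremal Kerr asymptotic stability for all `|a| < M` in a horizon-penetrating lab gauge from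
unweighted-sup-small ingoing slabs, plus `N ≥ 2` decoupling. Why it might fail: open beyond `|a| ≪ M`
(Klainerman–Szeftel); the far-zone smallness is an unweighted sup norm.
[cite: DafermosRodnianski2008, Conj. 5.1] [cite: KlainermanSzeftel2023, Thm. 1.1] [cite: arXiv210408222, §1] -/
def Sig.stub_dynamicsOrtho : Prop :=
  ∃ k : ℕ,
  ∀ (X : Type) [TopologicalSpace X] [ChartedSpace E3 X] [IsManifold (𝓡 3) ∞ X]
    [T2Space X] [SecondCountableTopology X] [ConnectedSpace X] (D : InitialDataSet (𝓡 3) X),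
    D ∈ admissibleVacuumData X → ∀ 𝒟 : VacuumCauchyDevelopment D, 𝒟.IsMaximal →
    Summit.FinalStateConjecture.HasCompleteNullInfinity 𝒟.toCauchyDevelopment →
    ∀ (N : ℕ) (M a r₀ : Fin N → ℝ) (mo : Fin N → ↥lorentzGroup × E4),
    OrthoConfig M a r₀ mo → Recurs 𝒟 k N M a r₀ mo →
    ∃ (N' : ℕ) (M' a' r₀' : Fin N' → ℝ) (mo' : Fin N' → ↥lorentzGroup × E4),
      OrthoConfig M' a' r₀' mo' ∧ GlobalGauge 𝒟 3 N' M' a' r₀' mo'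

/-- **Signature of stub 2 — PACKAGING on the orthochronous sector, `N ≥ 1` holes** (c5's
`stub_packagingOrtho` restricted to `0 < N`; w2's corrected signature: regularity `3`, orthochronous motions): for
every admissible datum and every MGHD with complete `𝓘⁺`, a convergent global gauge of regularity `3` to an
orthochronous sub-extremal horizon-penetrating configuration WITH AT LEAST ONE HOLE packages into an honest exterior
decomposition (`Birth.HonestExterior`). Content (w2 §2–5): edge = event horizon is forced; per-hole charts
`Φ ∘ (id + χ(r) s ∂ᵣ)` with `s` the `C³`-small late horizon displacement; flat chart = `Φ` on the late half-space
minus sublinear tubes; lab time is a time function on the gauge image; the cylinders `{rᵢ = r₀ᵢ}` are one-way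
membranes; no frontier at infinity; `J⁻` of entire leaves; orientation by continuity from the far-zone sign. Why it
might fail: the late-horizon regularity lemma (stable manifold of the null geodesic flow under a `C³`-small
perturbation WITHOUT rate) and the properness facts are thousands of lines of Lorentzian causal /
invariant-manifold theory absent from the tree. [cite: DafermosLuk2017, Conjecture 1 (b)–(c)]
[cite: arXiv210408222, §1] [cite: ONeill1983, Ch. 14] -/
def Sig.stub_packagingOrthoPos : Prop :=
  ∀ (X : Type) [TopologicalSpace X] [ChartedSpace E3 X] [IsManifold (𝓡 3) ∞ X]
    [T2Space X] [SecondCountableTopology X] [ConnectedSpace X] (D : InitialDataSet (𝓡 3) X),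
    D ∈ admissibleVacuumData X → ∀ 𝒟 : VacuumCauchyDevelopment D, 𝒟.IsMaximal →
    Summit.FinalStateConjecture.HasCompleteNullInfinity 𝒟.toCauchyDevelopment →
    ∀ (N : ℕ) (M a r₀ : Fin N → ℝ) (mo : Fin N → ↥lorentzGroup × E4), 0 < N →
    OrthoConfig M a r₀ mo → GlobalGauge 𝒟 3 N M a r₀ mo → HonestExterior 𝒟

/-- **Signature of stub 3 — the WHITE-HOLE SECTOR of the filed crux** (unchanged from c5): there is a regularity
`k` such that for every admissible datum, every MGHD with complete `𝓘⁺` and every sub-extremal horizon-penetrating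
configuration with SOME non-orthochronous motion (`Λᵢ = Λ₀·T`: the reference `boostedKerrBilin Λᵢ cᵢ Mᵢ aᵢ` is then
the OUTGOING, white-hole Kerr–Schild form, `kerr_bilin_timeReversal_eq_outgoing` p161997), recurrence at regularity
`k` forces an honest exterior decomposition. Crux-sized (p165128: it contains the pointwise final-state assertion
for white-hole-emergent admissible data); registered to be CUT by the planner's restatement or promoted, never
briefed. [cite: DafermosLuk2017, Conjecture 1] [cite: arXiv08110354, §5.1] -/
def Sig.stub_whiteHoleSector : Prop :=
  ∃ k : ℕ,
  ∀ (X : Type) [TopologicalSpace X] [ChartedSpace E3 X] [IsManifold (𝓡 3) ∞ X]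
    [T2Space X] [SecondCountableTopology X] [ConnectedSpace X] (D : InitialDataSet (𝓡 3) X),
    D ∈ admissibleVacuumData X → ∀ 𝒟 : VacuumCauchyDevelopment D, 𝒟.IsMaximal →
    Summit.FinalStateConjecture.HasCompleteNullInfinity 𝒟.toCauchyDevelopment →
    ∀ (N : ℕ) (M a r₀ : Fin N → ℝ) (mo : Fin N → ↥lorentzGroup × E4),
    (∀ i, Kerr.IsSubextremal (M i) (a i) ∧
      r₀ i ∈ Ioo (Kerr.rMinus (M i) (a i)) (Kerr.rPlus (M i) (a i))) →
    (∃ i, ¬ Summit.FinalStateConjecture.IsOrthochronous (mo i).1) →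
    Recurs 𝒟 k N M a r₀ mo → HonestExterior 𝒟

/-- **Signature of stub 4 — DISPERSAL EXHAUSTION** (the one new theorem of the `N = 0` packaging; stated in
Theorems-importable vocabulary). Let `Φ : U → 𝒟` be an ANCHORED FLAT LATE CHART of a vacuum Cauchy development
after the base time `τb`: smooth, an open embedding, `U ⊇ {x⁰ > τb}`, `range Φ ⊆ J⁺(ιX)`, pointwise `C⁰` anchor
`‖Φ^* g − η‖ ≤ 1/4` and `Φ_*∂₀` future-directed on `{x⁰ > τb}`. Then for `τb < τ₁ ≤ τ` every point of the
self-determined exterior `J⁺(ιX) ∩ I⁻(Φ{x⁰ > τ₁})` outside the late image `Φ{x⁰ > τ}` lies in the causal past of the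
slab `Φ{x⁰ = τ}`. Proof route: `p ≪ c = Φ z`; if `z⁰ ≤ τ` ride the chart vertical from `c` up to the slab
(`Restart.mem_chronologicalFuture_of_eq_add_smul`); else FIRST ENTRY `s₀` of the timelike curve into the open set
`Φ{x⁰ > τ}`, which is a future set (`FutureSet.forall_mem_range` for `Φ|{x⁰ > τ}`), so the curve stays inside on
`(s₀, b]`; its lift (`FutureSet.lift_cone`) has increasing chart time `> τ` and displacement `≤ 2 Δx⁰`
(`FutureSet.norm_sub_le_of_hasDerivAt`), hence converges in `U` as `s ↓ s₀`; the limit point is `Φ y*` with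
`y*⁰ = τ` (it is not in the open late image), so `p ≤ γ s₀ ∈ Φ{x⁰ = τ}`. [cite: ONeill1983, Ch. 14 pp. 402–403]
[cite: DafermosLuk2017, Conjecture 1] -/
def Sig.stub_flatExhaustion : Prop :=
  ∀ (X : Type) [TopologicalSpace X] [ChartedSpace E3 X] [IsManifold (𝓡 3) ∞ X]
    [T2Space X] [SecondCountableTopology X] [ConnectedSpace X] (D : InitialDataSet (𝓡 3) X)
    (𝒟 : VacuumCauchyDevelopment D) (τb : ℝ) (U : Opens E4) (Φ : U → 𝒟.carrier),
    ContMDiff 𝓘(ℝ, E4) (𝓡 4) ∞ Φ → Topology.IsOpenEmbedding Φ →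
    {x : E4 | τb < x 0} ⊆ (U : Set E4) →
    range Φ ⊆ 𝒟.metric.causalFuture 𝒟.timeOrientation (range 𝒟.embed) →
    (∀ y : U, τb < y.1 0 → ‖𝒟.toSpacetime.deviation (Minkowski.backgroundOn U) Φ y‖ ≤ 1 / 4) →
    (∀ y : U, τb < y.1 0 →
      𝒟.timeOrientation.IsFutureDirected (mfderiv 𝓘(ℝ, E4) (𝓡 4) Φ y (E4.basisVector 0))) →
    ∀ τ₁ τ : ℝ, τb < τ₁ → τ₁ ≤ τ →
      Summit.FinalStateConjecture.exteriorOf 𝒟.toCauchyDevelopment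
          (Φ '' (Minkowski.backgroundOn U).lateRegion τ₁) \
        Φ '' (Minkowski.backgroundOn U).lateRegion τ ⊆
      𝒟.metric.causalPast 𝒟.timeOrientation (Φ '' (Minkowski.backgroundOn U).timeSlab τ)

/-- **Signature of stub 5 — DISPERSAL DECOMPOSITION** (`decomp_of_convergentChart` of crux stmt-14665 plus the
orientation clause; Theorems-importable vocabulary): a convergent (`C²`) flat late chart `Φ : U → 𝒟` on
`U ⊇ {x⁰ > τ₁}`, which is a late chart into its self-determined exterior `J⁺(ιX) ∩ I⁻(Φ{x⁰ > τ₁})`, exhausts it at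
every chart time `τ ≥ τ₁`, and has `Φ_*∂₀` future-directed on `{x⁰ > τ₁}`, gives an `N = 0` final-state
decomposition `d` (`flatChart = Φ`, `τ₀ = τ₁`) of `O = exteriorOf 𝒟 d.charted` with (vacuously) sub-extremal holes,
`HasExhaustiveCharts d` and `IsFutureOriented d` — the body of `Birth.HonestExterior 𝒟`.
[cite: DafermosLuk2017, Conjecture 1] [cite: ChristodoulouKlainerman1993, Thm. 1.0.2] -/
def Sig.stub_flatDecomp : Prop :=
  ∀ (X : Type) [TopologicalSpace X] [ChartedSpace E3 X] [IsManifold (𝓡 3) ∞ X]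
    [T2Space X] [SecondCountableTopology X] [ConnectedSpace X] (D : InitialDataSet (𝓡 3) X)
    (𝒟 : VacuumCauchyDevelopment D) (τ₁ : ℝ) (U : Opens E4) (Φ : U → 𝒟.carrier),
    {x : E4 | τ₁ < x 0} ⊆ (U : Set E4) →
    𝒟.toSpacetime.IsLateChart (Minkowski.backgroundOn U)
      (Summit.FinalStateConjecture.exteriorOf 𝒟.toCauchyDevelopment
        (Φ '' (Minkowski.backgroundOn U).lateRegion τ₁)) τ₁ Φ →
    Tendsto (fun τ ↦ 𝒟.toSpacetime.deviationCk (Minkowski.backgroundOn U) Φ 2 τ) atTop (𝓝 0) →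
    (∀ τ : ℝ, τ₁ ≤ τ →
      Summit.FinalStateConjecture.exteriorOf 𝒟.toCauchyDevelopment
          (Φ '' (Minkowski.backgroundOn U).lateRegion τ₁) \
        Φ '' (Minkowski.backgroundOn U).lateRegion τ ⊆
      𝒟.metric.causalPast 𝒟.timeOrientation (Φ '' (Minkowski.backgroundOn U).timeSlab τ)) →
    (∀ y : U, τ₁ < y.1 0 →
      𝒟.timeOrientation.IsFutureDirected (mfderiv 𝓘(ℝ, E4) (𝓡 4) Φ y (E4.basisVector 0))) →
    ∃ (O : Set 𝒟.carrier) (d : FinalStateDecomposition 𝒟.toSpacetime O 2),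
      (∀ i, Kerr.IsSubextremal (d.mass i) (d.spin i)) ∧
      O = Summit.FinalStateConjecture.exteriorOf 𝒟.toCauchyDevelopment d.charted ∧
      Summit.FinalStateConjecture.HasExhaustiveCharts d ∧
      Summit.FinalStateConjecture.IsFutureOriented d

/-! ### §2 The registered stubs (the ONLY `sorry`s of this file) -/

/-- Registered stub 1 (DYNAMICS on the orthochronous sector; open-problem size, lead-held). See
`Sig.stub_dynamicsOrtho`. -/
theorem stub_dynamicsOrtho : Sig.stub_dynamicsOrtho := by
  sorry

/-- Registered stub 2 (PACKAGING on the orthochronous sector, `N ≥ 1`; XL). See `Sig.stub_packagingOrthoPos`. -/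
theorem stub_packagingOrthoPos : Sig.stub_packagingOrthoPos := by
  sorry

/-- Registered stub 3 (the WHITE-HOLE SECTOR of the filed crux; crux-sized, to be cut by the restatement or
promoted). See `Sig.stub_whiteHoleSector`. -/
theorem stub_whiteHoleSector : Sig.stub_whiteHoleSector := by
  sorry

/-- Registered stub 4 (DISPERSAL EXHAUSTION; M). See `Sig.stub_flatExhaustion`. -/
theorem stub_flatExhaustion : Sig.stub_flatExhaustion := by
  sorry

/-- Registered stub 5 (DISPERSAL DECOMPOSITION; S). See `Sig.stub_flatDecomp`. -/
theorem stub_flatDecomp : Sig.stub_flatDecomp := by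
  sorry

/-! ### §3 The `N = 0` packaging, proved modulo stubs 4–5 -/

section Flat

variable {X : Type} [TopologicalSpace X] [ChartedSpace E3 X] [IsManifold (𝓡 3) ∞ X]
  [ConnectedSpace X] {D : InitialDataSet (𝓡 3) X}

/-- **Anchor from a global gauge, `N = 0`.** A global gauge along a profile `δ → 0` to the EMPTY configuration is
an anchored flat late chart from some base time `τb ≥ τ₀` on: the far zone of every leaf is the whole leaf (no
holes), so the leafwise `C³` sup bound `≤ δ(τ)` yields, once `δ ≤ 1/4`, the pointwise `C⁰` anchor
`‖Φ^* g − η‖ ≤ 1/4` (the `m = 0` term of the sup norm at the point, `enorm_iteratedFDeriv_le_supCkENorm`), and the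
orientation clause is `Φ_*∂₀` future-directed at every late point. DHRT arXiv:2104.08222, §1 (sup-norm closeness in
one global gauge). [cite: arXiv210408222, §1] -/
theorem anchor_of_gaugeAlong (𝒟 : VacuumCauchyDevelopment D) {M a r₀ : Fin 0 → ℝ}
    {mo : Fin 0 → ↥lorentzGroup × E4} {δ : ℝ → ℝ} (hδ : Tendsto δ atTop (𝓝 0))
    (hG : GaugeAlong 𝒟 3 0 M a r₀ mo δ) :
    ∃ (τb : ℝ) (U : Opens E4) (Φ : U → 𝒟.carrier),
      ContMDiff 𝓘(ℝ, E4) (𝓡 4) ∞ Φ ∧ Topology.IsOpenEmbedding Φ ∧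
      {x : E4 | τb < x 0} ⊆ (U : Set E4) ∧
      range Φ ⊆ 𝒟.metric.causalFuture 𝒟.timeOrientation (range 𝒟.embed) ∧
      (∀ y : U, τb < y.1 0 → ‖𝒟.toSpacetime.deviation (Minkowski.backgroundOn U) Φ y‖ ≤ 1 / 4) ∧
      (∀ y : U, τb < y.1 0 →
        𝒟.timeOrientation.IsFutureDirected (mfderiv 𝓘(ℝ, E4) (𝓡 4) Φ y (E4.basisVector 0))) ∧
      (∀ τ : ℝ, τb < τ →
        𝒟.toSpacetime.deviationCk (Minkowski.backgroundOn U) Φ 2 τ ≤ ENNReal.ofReal (δ τ)) := by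
  unfold GaugeAlong at hG
  obtain ⟨U, Φ, τ₀, R, hsmooth, hemb, hU, hrange, -, -, hleaf⟩ := hG
  -- base time: `δ ≤ 1/4` beyond it, and later than `τ₀`
  obtain ⟨T, hT⟩ : ∃ T : ℝ, ∀ τ, T ≤ τ → δ τ ≤ 1 / 4 :=
    eventually_atTop.mp (hδ.eventually (ge_mem_nhds (by norm_num : (0 : ℝ) < 1 / 4)))
  obtain ⟨τb, hτ₀b, hTb⟩ : ∃ τb : ℝ, τ₀ ≤ τb ∧ T ≤ τb := ⟨max τ₀ T, le_max_left _ _, le_max_right _ _⟩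
  -- the far-zone (= whole-leaf) clause bounds every `Cᵏ` slab deviation, `k ≤ 3`
  have hCk : ∀ τ : ℝ, τ₀ < τ → ∀ k : ℕ, k ≤ 3 →
      supCkENorm (Subtype.val '' (Minkowski.backgroundOn U).timeSlab τ) k
        (𝒟.toSpacetime.deviationExtend (Minkowski.backgroundOn U) Φ) ≤ ENNReal.ofReal (δ τ) := by
    intro τ hτ k hk
    have h := (hleaf τ hτ).2.2.1
    refine le_trans ?_ h
    refine le_trans (supCkENorm_mono ?_ k _) (supCkENorm_mono_right _ hk _)
    rintro _ ⟨x', hx', rfl⟩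
    exact ⟨hx', fun j ↦ j.elim0, fun j ↦ j.elim0⟩
  refine ⟨τb, U, Φ, hsmooth, hemb, ?_, hrange, ?_, ?_, fun τ hτ ↦ hCk τ (lt_of_le_of_lt hτ₀b hτ) 2 (by norm_num)⟩
  · intro x hx
    exact hU ⟨lt_of_le_of_lt hτ₀b hx, fun j ↦ j.elim0⟩
  · intro y hy
    have hτ : τ₀ < y.1 0 := lt_of_le_of_lt hτ₀b hy
    have h0 : supCkENorm (Subtype.val '' (Minkowski.backgroundOn U).timeSlab (y.1 0)) 0
        (𝒟.toSpacetime.deviationExtend (Minkowski.backgroundOn U) Φ) ≤ ENNReal.ofReal (1 / 4) :=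
      (hCk _ hτ 0 (by norm_num)).trans (ENNReal.ofReal_le_ofReal (hT _ (hTb.trans hy.le)))
    have hmem : y ∈ (Minkowski.backgroundOn U).timeSlab (y.1 0) := rfl
    have h' := (enorm_iteratedFDeriv_le_supCkENorm (le_refl 0) (mem_image_of_mem Subtype.val hmem)
      (𝒟.toSpacetime.deviationExtend (Minkowski.backgroundOn U) Φ)).trans h0
    rw [← ofReal_norm, ENNReal.ofReal_le_ofReal_iff (by norm_num), norm_iteratedFDeriv_zero,
      Spacetime.deviationExtend_coe] at h'
    exact h'
  · intro y hy
    have hτ : τ₀ < y.1 0 := lt_of_le_of_lt hτ₀b hy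
    exact (hleaf (y.1 0) hτ).2.2.2 y rfl (fun j ↦ j.elim0)

/-- **Dispersal packaging** (`N = 0` case of the packaging step of line `registered`): a convergent global gauge
of regularity `3` to the EMPTY configuration packages into an honest exterior decomposition, granted the two
dispersal stubs. The gauge is anchored from a base time `τb` on (`anchor_of_gaugeAlong`); `stub_flatExhaustion`
gives the exhaustion of the self-determined exterior of `Φ{x⁰ > τb + 1}` at every later chart time; the late
image is past-full along chart verticals (`Restart.image_lateRegion_subset_chronologicalPast`, with
`g(dΦ∂₀, dΦ∂₀) ≤ −3/4` from the anchor, `FutureSet.val_mfderiv_basisVector_zero_le`), which makes `Φ` a late chart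
into that exterior; the `C²` slab deviation is `≤ δ(τ) → 0`; `stub_flatDecomp` packages. Dafermos–Luk 2017,
Conjecture 1 (`N = 0`: dispersal). [cite: DafermosLuk2017, Conjecture 1] -/
theorem packagingFlat_of (hexh : Sig.stub_flatExhaustion) (hdec : Sig.stub_flatDecomp)
    [T2Space X] [SecondCountableTopology X] (𝒟 : VacuumCauchyDevelopment D)
    {M a r₀ : Fin 0 → ℝ} {mo : Fin 0 → ↥lorentzGroup × E4} (hgg : GlobalGauge 𝒟 3 0 M a r₀ mo) :
    HonestExterior 𝒟 := by
  obtain ⟨δ, hδ, hG⟩ := hgg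
  obtain ⟨τb, U, Φ, hsmooth, hemb, hU, hrange, hdev, hfut, hC2⟩ := anchor_of_gaugeAlong 𝒟 hδ hG
  set τ₁ : ℝ := τb + 1 with hτ₁
  have hτb₁ : τb < τ₁ := by simp [hτ₁]
  -- exhaustion from `τ₁` on
  have hexh₁ : ∀ τ : ℝ, τ₁ ≤ τ →
      Summit.FinalStateConjecture.exteriorOf 𝒟.toCauchyDevelopment
          (Φ '' (Minkowski.backgroundOn U).lateRegion τ₁) \
        Φ '' (Minkowski.backgroundOn U).lateRegion τ ⊆
      𝒟.metric.causalPast 𝒟.timeOrientation (Φ '' (Minkowski.backgroundOn U).timeSlab τ) :=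
    fun τ hτ ↦ hexh X D 𝒟 τb U Φ hsmooth hemb hU hrange hdev hfut τ₁ τ hτb₁ hτ
  -- the vertical differential is uniformly timelike and future-directed on `{x⁰ > τb}`
  have hvert : ∀ y : U, τb < y.1 0 →
      𝒟.metric.val (Φ y) (mfderiv 𝓘(ℝ, E4) (𝓡 4) Φ y (E4.basisVector 0))
          (mfderiv 𝓘(ℝ, E4) (𝓡 4) Φ y (E4.basisVector 0)) ≤ -(3 / 4) ∧
        𝒟.timeOrientation.IsFutureDirected (mfderiv 𝓘(ℝ, E4) (𝓡 4) Φ y (E4.basisVector 0)) :=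
    fun y hy ↦ ⟨FutureSet.val_mfderiv_basisVector_zero_le (𝓢 := 𝒟.toSpacetime) Φ y (hdev y hy), hfut y hy⟩
  -- `Φ` is a late chart into the self-determined exterior of its late image after `τ₁`
  have hU₁ : {x : E4 | τ₁ < x 0} ⊆ (U : Set E4) := fun x hx ↦ hU (lt_trans hτb₁ hx)
  have hlate : 𝒟.toSpacetime.IsLateChart (Minkowski.backgroundOn U)
      (Summit.FinalStateConjecture.exteriorOf 𝒟.toCauchyDevelopment
        (Φ '' (Minkowski.backgroundOn U).lateRegion τ₁)) τ₁ Φ := by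
    refine ⟨hsmooth, ?_, ?_⟩
    · have hopen : IsOpen ((Minkowski.backgroundOn U).lateRegion τ₁) :=
        isOpen_lt continuous_const ((PiLp.continuous_apply 2 _ 0).comp continuous_subtype_val)
      exact hemb.comp hopen.isOpenEmbedding_subtypeVal
    · intro q hq
      refine ⟨hrange (image_subset_range _ _ hq), ?_⟩
      exact Restart.image_lateRegion_subset_chronologicalPast (𝓢 := 𝒟.toSpacetime) hsmooth hU hvert
        hτb₁.le hq
  -- `C²` convergence on the slabs
  have hconv : Tendsto (fun τ ↦ 𝒟.toSpacetime.deviationCk (Minkowski.backgroundOn U) Φ 2 τ)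
      atTop (𝓝 0) := by
    have h0 : Tendsto (fun τ ↦ ENNReal.ofReal (δ τ)) atTop (𝓝 0) := by
      have := ENNReal.tendsto_ofReal hδ
      rwa [ENNReal.ofReal_zero] at this
    refine tendsto_of_tendsto_of_tendsto_of_le_of_le' tendsto_const_nhds h0
      (Eventually.of_forall fun _ ↦ zero_le) ?_
    filter_upwards [eventually_gt_atTop τb] with τ hτ using hC2 τ hτ
  exact hdec X D 𝒟 τ₁ U Φ hU₁ hlate hconv hexh₁ (fun y hy ↦ hfut y (lt_trans hτb₁ hy))

end Flat

/-! ### §4 Composition: the five stubs imply the crux, BY NAME (real proof, no `sorry`) -/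

/-- **The sector split delivers an honest exterior from recurrence alone**: with `k := max k₁ k₂` (the dynamics
stub's and the white-hole stub's regularities; recurrence is antitone in `k`), every admissible MGHD with complete
`𝓘⁺` recurring at regularity `k` to a sub-extremal horizon-penetrating configuration admits an honest exterior
decomposition — by DYNAMICS then PACKAGING (dispersal packaging if the captured configuration is empty, `N ≥ 1`
packaging otherwise) if every motion is orthochronous, by the white-hole stub otherwise. [folklore] -/
theorem honestExterior_of_recurs (hdyn : Sig.stub_dynamicsOrtho) (hpack : Sig.stub_packagingOrthoPos)
    (hwh : Sig.stub_whiteHoleSector) (hexh : Sig.stub_flatExhaustion) (hdec : Sig.stub_flatDecomp) :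
    ∃ k : ℕ, ∀ (X : Type) [TopologicalSpace X] [ChartedSpace E3 X] [IsManifold (𝓡 3) ∞ X]
      [T2Space X] [SecondCountableTopology X] [ConnectedSpace X] (D : InitialDataSet (𝓡 3) X),
      D ∈ admissibleVacuumData X → ∀ 𝒟 : VacuumCauchyDevelopment D, 𝒟.IsMaximal →
      Summit.FinalStateConjecture.HasCompleteNullInfinity 𝒟.toCauchyDevelopment →
      ∀ (N : ℕ) (M a r₀ : Fin N → ℝ) (mo : Fin N → ↥lorentzGroup × E4),
      (∀ i, Kerr.IsSubextremal (M i) (a i) ∧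
        r₀ i ∈ Ioo (Kerr.rMinus (M i) (a i)) (Kerr.rPlus (M i) (a i))) →
      Recurs 𝒟 k N M a r₀ mo → HonestExterior 𝒟 := by
  obtain ⟨k₁, hk₁⟩ := hdyn
  obtain ⟨k₂, hk₂⟩ := hwh
  refine ⟨max k₁ k₂, ?_⟩
  intro X _ _ _ _ _ _ D hD 𝒟 hmax hscri N M a r₀ mo hsub hrec
  by_cases hortho : ∀ i, Summit.FinalStateConjecture.IsOrthochronous (mo i).1
  · have hcfg : OrthoConfig M a r₀ mo := fun i ↦ ⟨(hsub i).1, (hsub i).2, hortho i⟩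
    obtain ⟨N', M', a', r₀', mo', hcfg', hgg⟩ :=
      hk₁ X D hD 𝒟 hmax hscri N M a r₀ mo hcfg (recurs_anti 𝒟 (le_max_left k₁ k₂) hrec)
    rcases Nat.eq_zero_or_pos N' with hN' | hN'
    · subst hN'
      exact packagingFlat_of hexh hdec 𝒟 hgg
    · exact hpack X D hD 𝒟 hmax hscri N' M' a' r₀' mo' hN' hcfg' hgg
  · push Not at hortho
    exact hk₂ X D hD 𝒟 hmax hscri N M a r₀ mo hsub hortho (recurs_anti 𝒟 (le_max_right k₁ k₂) hrec)

/-- **The line closes the crux.** DYNAMICS (`stub_dynamicsOrtho`), `N ≥ 1` PACKAGING (`stub_packagingOrthoPos`),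
the WHITE-HOLE SECTOR (`stub_whiteHoleSector`) and the two DISPERSAL stubs (`stub_flatExhaustion`,
`stub_flatDecomp`) imply `KerrnessPropagates.KillingSpinorEndgame` BY NAME: take `k := max k₁ k₂`; a development
recurring to a sub-extremal `p` gets an honest `(O, d)` (`honestExterior_of_recurs`); the crux's interior-lemma
hypothesis (ii) applied to `(O, d)` gives `RaysStayInClosure O`. Pure logic over the five stub statements.
[folklore] -/
theorem KillingSpinorEndgame_of :
    Sig.stub_dynamicsOrtho → Sig.stub_packagingOrthoPos → Sig.stub_whiteHoleSector →
      Sig.stub_flatExhaustion → Sig.stub_flatDecomp → KillingSpinorEndgame := by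
  intro hdyn hpack hwh hexh hdec
  obtain ⟨k, hk⟩ := honestExterior_of_recurs hdyn hpack hwh hexh hdec
  refine ⟨k, ?_⟩
  intro X _ _ _ _ _ _ D hD 𝒟 hmax hscri hrec hint
  obtain ⟨N, M, a, r₀, mo, hsub, hrec⟩ := hrec
  obtain ⟨O, d, hdsub, hO, hexh', hfo⟩ := hk X D hD 𝒟 hmax hscri N M a r₀ mo hsub hrec
  exact ⟨O, d, hdsub, hO, hint O d hdsub hO hexh' hfo, hexh', hfo⟩

/-- Sanity: the composition applies to the five registered stubs as stated — the crux BY NAME, closed modulo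
exactly the five stubs (`KillingSpinorEndgame_of` itself is sorry-free). -/
example : KillingSpinorEndgame :=
  KillingSpinorEndgame_of stub_dynamicsOrtho stub_packagingOrthoPos stub_whiteHoleSector
    stub_flatExhaustion stub_flatDecomp

end

end Summit.FinalStateConjecture.FinalStateConjecture.Cruxes.KillingSpinorEndgame.Registered
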